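import Summits.BirchSwinnertonDyer.BirchSwinnertonDyer.Theorems.EisensteinPrimesWeakLeopoldtAboveCharModuleAt
import Summits.BirchSwinnertonDyer.BirchSwinnertonDyer.Theorems.EisensteinPrimesWeakLeopoldtAboveOfSqueezeOfTateTC
import Literature.NumberTheory.IwasawaTheory.Greenberg2006.CohomologyCofiniteGenerationLeTwoOfTateTC
import HarnessLib

/-!
# T28b re-typing (`OfTateTC`: Tate's formula by name AT TOTALLY COMPLEX FIELDS) of `EisensteinPrimesWeakLeopoldtAboveCharModuleAt.lean`

Route `EisensteinPrimes` (rung K5), crux 2 `GoodLatticeBDPValue` (stmt-BirchSwinnertonDyer-19032), line `halves`;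
cell `bsd-eis`, seat `bsd-line-x1-p1` LEAD g8, lane «T28 / TATE RE-PLUMB» (helper, `--supports`).

This file re-types, token for token, the theorems of `EisensteinPrimesWeakLeopoldtAboveCharModuleAt` that carry
Greenberg 2006 Prop. 3.2 BY NAME (`h32 : (∀ (L : Type) [Field L] [NumberField L] [IsTotallyComplex L], Literature.NumberTheory.GaloisCohomology.tateGlobalEulerPoincareCharacteristic L)`, cofinite generation of
`Hⁱ(K_Σ/K, 𝒟)` / `Hⁱ(K_v, 𝒟)` for EVERY `i`, every number field, every prime) with that hypothesis replaced by
Tate's global Euler–Poincaré characteristic BY NAME AT TOTALLY COMPLEX FIELDS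
(`h32 : ∀ L [IsTotallyComplex L], GaloisCohomology.tateGlobalEulerPoincareCharacteristic L`, Milne ADT I Thm. 5.1 — the shape the
tree's class-formation road to Tate's theorem delivers; where a theorem's field was not syntactically totally complex an
`[IsTotallyComplex K]` binder is added and supplied by its callers from `IsImaginaryQuadratic K` / `∀ w, w.IsComplex`): on this line
Prop. 3.2 is read in degrees `i ≤ 2` only (global clause; the local clause is the unconditional
`Greenberg2006.prop32_local_holds`), and in those degrees it follows from Tate's formula alone
(`Greenberg2006.prop32_global_le_two_of_tate_tc`, file `CohomologyCofiniteGenerationLeTwoOfTateTC`: `H⁰`/`H¹` of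
`G_{K,S}` with finite coefficients are finite unconditionally, `H²` by Tate, and Greenberg's dévissage for `Hⁿ`
involves `Hⁿ`, `Hⁿ⁻¹` only).  Statements are otherwise VERBATIM (same binder order, new names `<name>_ofTateTC`; supersedes this seat's `…OfTate` twin, which took Tate's formula at every number field);
proofs are the tree proofs with the two reading lemmas substituted and the re-typed callees called.
EFFECT for the crux: Harari Thm. 17.13 (a) (`poitouTate_restricted_three_le`) is no longer consumed through
Prop. 3.2 at every number field, only at totally complex fields (Greenberg 2006 Prop. 4.1 is typed totally
imaginary; `cd_p ≤ 2` and the `H²` bookkeeping at the imaginary quadratic `K`), which is what the tree's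
class-formation road (`RestrictedRamificationCdTwoOfH3Mu`, lane PT3-TC) proves.

Theorems only; no definition, no named fact, no `sorry`, no instance. HONEST FRAMING: conditional on the PUBLISHED
named facts carried as hypotheses; closes nothing by itself; no summit statement / BSD / the crux is proved here.

## References
* R. Greenberg, *On the structure of certain Galois cohomology groups*, Doc. Math. Extra Vol. Coates (2006), Prop. 3.2 (p. 358). [Greenberg2006]
* J. S. Milne, *Arithmetic Duality Theorems*, 2nd ed. (2006), I Thm. 5.1 (p. 67). [MilneADT2006]
* (the references of the re-typed file apply verbatim)
-/

set_option autoImplicit false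

noncomputable section

open scoped Classical
open NumberField IsDedekindDomain Field Multiplicative WeierstrassCurve
open Literature.NumberTheory.EllipticCurves Literature.NumberTheory.EllipticCurves.GreenbergSelmer
  Literature.NumberTheory.EllipticCurves.GreenbergVatsal2000 Literature.NumberTheory.GaloisRepresentations
  Literature.NumberTheory.GaloisCohomology
  Literature.NumberTheory.EllipticCurves.KellerYin2024 Literature.NumberTheory.EllipticCurves.IwasawaDual
  Literature.NumberTheory.IwasawaTheory Literature.NumberTheory.IwasawaTheory.Greenberg2016
  Literature.NumberTheory.IwasawaTheory.Greenberg2006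
  Summit.BirchSwinnertonDyer.BirchSwinnertonDyer.Theorems.GreenbergFullAtSelmer
  Summit.BirchSwinnertonDyer.BirchSwinnertonDyer.Theorems.AcTwistDeformationResidualPair
  Summit.BirchSwinnertonDyer.BirchSwinnertonDyer.Theorems.AcTwistDeformation
  Summit.BirchSwinnertonDyer.BirchSwinnertonDyer.Theorems.WeakLeopoldtAbove
  Summit.BirchSwinnertonDyer.BirchSwinnertonDyer.Theorems.WeakLeopoldtAboveOfSqueeze

namespace Summit.BirchSwinnertonDyer.BirchSwinnertonDyer.Theorems.WeakLeopoldtAboveCharModuleAt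

variable {K : Type} [Field K] [NumberField K] {p : ℕ} [Fact p.Prime]

/-- **[T28b `OfTateTC` re-typing: Greenberg 2006 Prop. 3.2 by name ↦ Milne ADT I Thm. 5.1 by name AT TOTALLY COMPLEX FIELDS (Prop. 3.2 is read in degrees ≤ 2 and at totally complex fields only, `prop32_global_le_two_of_tate_tc`).]** [cite: MilneADT2006, I Thm. 5.1 (p. 67)] **WL above `K_∞` for the model `ℚ_p/ℤ_p(θ)`, from the `S₀`-imprimitive cotorsion of `H¹_{𝓕_nr^{S₀}}(K_∞, (F/𝒪)(θ))`**
(`∀ D : DatumDualData κ γ ((F/𝒪)(θ)) (bdpData … v̄) S₀, D.X` finitely generated torsion — one datum suffices and one exists),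
`θ` unramified outside `Σ = {v, v̄} ∪ Sf` (`h`), `2 < p = v v̄` split in the imaginary quadratic `K` with (Heeg) for `N`, `κ`
anticyclotomic with topological generator `γ`, `Sf` = places over `N`; GRANTED Greenberg 2006 Props. 4.1, 4.2, §5 A, 3.2 and
`cd_p(G_{K,Σ}) ≤ 2` BY NAME. [cite: Greenberg2006, Thm. 3 p. 342, Props. 4.1–4.2, §5 A, Props. 3.2–3.6]
[cite: KellerYin2024, Thm. 1.2.2, Rem. 1.2.3 (ii) (arXiv:2402.12781v2 TeX L676–712)] [cite: GreenbergVatsal2000, §2 p. 20] -/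
theorem subsingleton_H_two_above_characterRep_of_cotorsion_at_ofTateTC (hCD2 : groupCdLE_two_galoisGroupUnramifiedOutside K)
    (h41 : prop41_globalEulerPoincareCorank) (h42 : prop42_localEulerPoincareCorank)
    (h5A : sec5A_localH2_subsingleton_of_LOC1) (h32 : (∀ (L : Type) [Field L] [NumberField L] [IsTotallyComplex L], Literature.NumberTheory.GaloisCohomology.tateGlobalEulerPoincareCharacteristic L))
    (hp : 2 < p) (hK : IsImaginaryQuadratic K) {N : ℕ} (hH : SatisfiesHeegnerHypothesis N K)
    {ι : K →+* ℚ_[p]} {v vbar : HeightOneSpectrum (𝓞 K)}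
    (hvι : ∀ x : 𝓞 K, x ∈ v.asIdeal ↔ ‖ι (x : K)‖ < 1)
    (hvbar : ((p : ℕ) : 𝓞 K) ∈ vbar.asIdeal) (hne : vbar ≠ v)
    (κ : ZpExtension K p) (hκ : κ.IsAnticyclotomic) (γ : absoluteGaloisGroup K) [Fact (κ.IsTopGenerator γ)]
    (Sf : Finset (HeightOneSpectrum (𝓞 K)))
    (hSf : ∀ w : HeightOneSpectrum (𝓞 K), w ∈ Sf ↔ ((N : ℤ) : 𝓞 K) ∈ w.asIdeal)
    (θ : FramedGaloisRep K (padicCoeffIntegers (∅ : Set (PadicAlgCl p))) 1)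
    (S₀ : Set (HeightOneSpectrum (𝓞 K)))
    (hSθ : ∀ D : DatumDualData κ γ (charModule (∅ : Set (PadicAlgCl p)) θ)
        (Castella2018.AcSelmer.bdpData (charModule (∅ : Set (PadicAlgCl p)) θ) p vbar) S₀,
      Module.Finite (IwasawaAlgebra p) D.X ∧ Module.IsTorsion (IwasawaAlgebra p) D.X ∧ muInvariant p D.X = 0)
    (hS : ∀ w : HeightOneSpectrum (𝓞 K), ((p : ℕ) : 𝓞 K) ∈ w.asIdeal →
      w ∈ (↑(insert v (insert vbar Sf)) : Set (HeightOneSpectrum (𝓞 K))))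
    (h : ramificationSubgroup K (↑(insert v (insert vbar Sf)) : Set (HeightOneSpectrum (𝓞 K))) ≤
      (unitChar θ).toMonoidHom.ker)
    [DiscreteTopology (QpModZp p)] [ContinuousSMul ℤ_[p] (QpModZp p)] :
    Subsingleton (((characterRepUnramified _ θ h).restrict
      (galoisGroupAboveSubtype (↑(insert v (insert vbar Sf)) : Set (HeightOneSpectrum (𝓞 K))) κ.kerSubgroup)).H 2) := by
  have hγ : κ.IsTopGenerator γ := Fact.out
  have hv : ((p : ℕ) : 𝓞 K) ∈ v.asIdeal := IwasawaTwoVariable.natCast_mem_asIdeal_of_norm_iff hvι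
  have hSp : ∀ w : HeightOneSpectrum (𝓞 K), ((p : ℕ) : 𝓞 K) ∈ w.asIdeal → w = v ∨ w = vbar :=
    fun w hw ↦ eq_or_eq_of_natCast_mem_of_ne hK.1 hv hvbar hne hw
  -- the canonical (discrete) topological instances of the twist-deformation model
  letI tΛ : TopologicalSpace (PowerSeries ℤ_[p]) := ⊥
  haveI : DiscreteTopology (PowerSeries ℤ_[p]) := ⟨rfl⟩
  haveI : IsTopologicalRing (PowerSeries ℤ_[p]) := inferInstance
  haveI : IsTopologicalAddGroup (BigRepModule ℤ_[p] p (QpModZp p)) := inferInstance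
  haveI : ContinuousSMul (PowerSeries ℤ_[p]) (BigRepModule ℤ_[p] p (QpModZp p)) := inferInstance
  -- ONE datum of `H¹_{𝓕_nr^{S₀}}(K_∞, (F/𝒪)(θ))^∨`, finitely generated torsion by the clause
  obtain ⟨D⟩ := nonempty_unrDualData_char (∅ : Set (PadicAlgCl p)) θ κ vbar S₀ hγ
  obtain ⟨hDfin, hDtor, -⟩ := hSθ D
  -- `corank_Λ S_{𝓛_v}(K, 𝐃₁(θ)) = 0` by the transport at `S₀`
  obtain ⟨hSel, -⟩ := hasCorank_fullAtSelmer_zero_of_datumDualData_at _ hS κ (characterRepUnramified _ θ h)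
    (charModuleEquiv θ).symm (charModuleEquiv_symm_galois _ θ h) S₀ (QpModZp.exists_pow_nsmul_eq_zero (p := p))
    (exists_pow_smul_cofree_eq_zero (∅ : Set (PadicAlgCl p)) θ) (isOpen_stabilizer_cofree (∅ : Set (PadicAlgCl p)) θ)
    hγ hv hne hSp D hDfin hDtor
  exact subsingleton_H_two_above_of_squeeze_character_ofTateTC hS κ (characterRepUnramified _ θ h) hCD2 h41 h42 h5A h32 hp.ne'
    (Finset.finite_toSet _) hK (LinearEquiv.refl ℤ_[p] (QpModZp p)) (characterRepUnramified_hscalar _ θ h)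
    (exists_local_apply_ne_one_of_mem_insert_insert hK hp hH κ hκ hv hvbar Sf hSf) hne hv hvbar hSel

/-- **[T28b `OfTateTC` re-typing: Greenberg 2006 Prop. 3.2 by name ↦ Milne ADT I Thm. 5.1 by name AT TOTALLY COMPLEX FIELDS (Prop. 3.2 is read in degrees ≤ 2 and at totally complex fields only, `prop32_global_le_two_of_tate_tc`).]** [cite: MilneADT2006, I Thm. 5.1 (p. 67)] **WL_ω / WL_1 IN THE CRUX'S BINDERS from v20.1's `↑Sf`-imprimitive cotorsion clause.** For `W/ℚ` elliptic, `2 < p`, `K`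
imaginary quadratic with (Heeg) for `N_E`, `v` through `ι`, `v̄ ≠ v` above `p`, `κ` anticyclotomic with topological generator `γ`,
a residual pair `θsub, θquot`, `Sf` ↔ places over `N_E`, `θ ∈ {θsub, θquot}` with the clause
`∀ D : DatumDualData κ γ (charModule ∅ θ) (AcSelmer.bdpData (charModule ∅ θ) p vbar) ↑Sf, Module.Finite ∧ Module.IsTorsion ∧
μ = 0` (halves v20.1 `stub_indexInputs` l.271–276, VERBATIM), and Greenberg 2006 Props. 4.1, 4.2, §5 A, 3.2 + `cd_p(G_{K,Σ}) ≤ 2`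
BY NAME: for EVERY continuous representation `ρM` of `G_{K,Σ}` (`Σ = {v, v̄} ∪ Sf`, any coefficient ring) on `charModule ∅ θ`
descending the `Γ_K`-action, **`Subsingleton ((ρM.restrict (galoisGroupAboveSubtype Σ κ.kerSubgroup)).H 2)`**.
[cite: Greenberg2006, Thm. 3 p. 342, Props. 4.1–4.2, §5 A, 3.2] [cite: KellerYin2024, Thm. 1.2.2, §1.4 (L1183–1330)]
[cite: NeukirchSchmidtWingberg2008, (8.3.18)] -/
theorem subsingleton_H_two_above_charModule_of_cotorsion_at_ofTateTC (hCD2 : groupCdLE_two_galoisGroupUnramifiedOutside K)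
    (h41 : prop41_globalEulerPoincareCorank) (h42 : prop42_localEulerPoincareCorank)
    (h5A : sec5A_localH2_subsingleton_of_LOC1) (h32 : (∀ (L : Type) [Field L] [NumberField L] [IsTotallyComplex L], Literature.NumberTheory.GaloisCohomology.tateGlobalEulerPoincareCharacteristic L))
    (W : WeierstrassCurve ℚ) [W.IsElliptic] (hp : 2 < p) (hK : IsImaginaryQuadratic K)
    (hH : SatisfiesHeegnerHypothesis (W.conductorNorm ℤ) K)
    {ι : K →+* ℚ_[p]} {v vbar : HeightOneSpectrum (𝓞 K)}
    (hvι : ∀ x : 𝓞 K, x ∈ v.asIdeal ↔ ‖ι (x : K)‖ < 1)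
    (hvbar : ((p : ℕ) : 𝓞 K) ∈ vbar.asIdeal) (hne : vbar ≠ v)
    (κ : ZpExtension K p) (hκ : κ.IsAnticyclotomic) (γ : absoluteGaloisGroup K) [Fact (κ.IsTopGenerator γ)]
    {θsub θquot : FramedGaloisRep K (padicCoeffIntegers (∅ : Set (PadicAlgCl p))) 1}
    (hpair : IsResidualPairOver (W.baseChange K) p θsub θquot)
    (Sf : Finset (HeightOneSpectrum (𝓞 K)))
    (hSf : ∀ w : HeightOneSpectrum (𝓞 K), w ∈ Sf ↔ ((W.conductorNorm ℤ : ℤ) : 𝓞 K) ∈ w.asIdeal)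
    (θ : FramedGaloisRep K (padicCoeffIntegers (∅ : Set (PadicAlgCl p))) 1) (hθ : θ = θsub ∨ θ = θquot)
    (hSθ : ∀ D : DatumDualData κ γ (charModule (∅ : Set (PadicAlgCl p)) θ)
        (Castella2018.AcSelmer.bdpData (charModule (∅ : Set (PadicAlgCl p)) θ) p vbar) (↑Sf : Set (HeightOneSpectrum (𝓞 K))),
      Module.Finite (IwasawaAlgebra p) D.X ∧ Module.IsTorsion (IwasawaAlgebra p) D.X ∧ muInvariant p D.X = 0)
    {R : Type} [CommRing R] [TopologicalSpace R] [Module R (charModule (∅ : Set (PadicAlgCl p)) θ)]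
    [ContinuousSMul R (charModule (∅ : Set (PadicAlgCl p)) θ)]
    (ρM : ContinuousRep (GaloisGroupUnramifiedOutside K (↑(insert v (insert vbar Sf)) : Set (HeightOneSpectrum (𝓞 K))))
      R (charModule (∅ : Set (PadicAlgCl p)) θ))
    (hρM : ∀ (σ : absoluteGaloisGroup K) (m : charModule (∅ : Set (PadicAlgCl p)) θ),
      ρM (toUnramifiedQuot K _ σ) m = σ • m) :
    Subsingleton ((ρM.restrict
      (galoisGroupAboveSubtype (↑(insert v (insert vbar Sf)) : Set (HeightOneSpectrum (𝓞 K))) κ.kerSubgroup)).H 2) := by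
  have hv : ((p : ℕ) : 𝓞 K) ∈ v.asIdeal := IwasawaTwoVariable.natCast_mem_asIdeal_of_norm_iff hvι
  have hS : ∀ w : HeightOneSpectrum (𝓞 K), ((p : ℕ) : 𝓞 K) ∈ w.asIdeal →
      w ∈ (↑(insert v (insert vbar Sf)) : Set (HeightOneSpectrum (𝓞 K))) :=
    mem_insert_insert_of_natCast_mem hK hv hvbar hne Sf
  have hSfS : ∀ w ∈ Sf, w ∈ (↑(insert v (insert vbar Sf)) : Set (HeightOneSpectrum (𝓞 K))) := fun w hw ↦ by
    rw [Finset.coe_insert, Finset.coe_insert]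
    exact Or.inr (Or.inr (Finset.mem_coe.mpr hw))
  have h : ramificationSubgroup K (↑(insert v (insert vbar Sf)) : Set (HeightOneSpectrum (𝓞 K))) ≤
      (unitChar θ).toMonoidHom.ker :=
    ramificationSubgroup_le_ker_unitChar_of_residualPair W hpair Sf hSf _ hSfS hS θ hθ
  haveI hAdisc : DiscreteTopology (QpModZp p) := QpModZp.discreteTopology p
  haveI : ContinuousSMul ℤ_[p] (QpModZp p) := QpModZp.continuousSMul p
  have hA := subsingleton_H_two_above_characterRep_of_cotorsion_at_ofTateTC hCD2 h41 h42 h5A h32 hp hK hH hvι hvbar hne κ hκ γ Sf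
    hSf θ _ hSθ hS h
  -- transport along `ψ = (charModuleEquiv θ)⁻¹`
  let η : QpModZp p ≃ₜ+ charModule (∅ : Set (PadicAlgCl p)) θ :=
    { (charModuleEquiv θ).symm with
      continuous_toFun := continuous_of_discreteTopology
      continuous_invFun := continuous_of_discreteTopology }
  have hη : ∀ (g : GaloisGroupUnramifiedOutside K (↑(insert v (insert vbar Sf)) : Set (HeightOneSpectrum (𝓞 K))))
      (a : QpModZp p), η (characterRepUnramified _ θ h g a) = ρM g (η a) := fun g a ↦ by
    obtain ⟨σ, rfl⟩ := toUnramifiedQuot_surjective K _ g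
    change (charModuleEquiv θ).symm _ = ρM _ ((charModuleEquiv θ).symm a)
    rw [charModuleEquiv_symm_galois, hρM]
  exact (subsingleton_H_restrict_iff_of_continuousAddEquiv (characterRepUnramified _ θ h) ρM η hη _ 2).mp hA

end Summit.BirchSwinnertonDyer.BirchSwinnertonDyer.Theorems.WeakLeopoldtAboveCharModuleAt

end
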